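import Summits.AtomisticToContinuum.BoseEinsteinCondensation.Theorems.DensityResponse.Negative.ForceBalanceStubMutations
import Summits.AtomisticToContinuum.BoseEinsteinCondensation.Theorems.DensityResponse.Negative.Tightness

/-!
# Negative lemmas for crux `DensityResponse` (stmt-AtomisticToContinuum-9481) — the exact strength of
# stub S2 `stub_constitutiveCore` of line `force-balance-constitutive`

Supports (does not close) stmt-AtomisticToContinuum-9481.  Refuter (drefute, generation 2) by-product,
stated against the lead's `Defs` module (`CoreIneq`, `ConstitutiveCore`, `ksupSq`, `sourceMean`, …) and
the landed Negative lemmas `coreIneq_of_lr_bound` (generation 1) and `forall_tilt_iff_sq_le`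
(Disproof gen 2, `Tightness`).  Sorry-free; no `Theses` declaration is asserted.

* The CHORD for a potential `w` at scattering-length PARAMETER `a` (constants `M, ρ₀, C, N₀`) is the
  conclusion of `BECThomsonPrinciple.DensityResponse` for `(v, M)` with `v ↦ w`, `a(v) ↦ a` (written out
  verbatim as a hypothesis; for `w = v`, `a = a(v)` it is literally the crux instance `h v hv M hM`).
* `coreIneq_of_chord` — **CHORD ⟹ CORE**: chord for `(w, a, M, ρ₀, C, N₀)` `→ CoreIneq w a M ρ₀ κ (4C·max κ 1) N₀`
  for every real `κ`.  On a sub-ground state at drive `s` the tilt family of the chord is the square-root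
  bound `m² ≤ 4(E−E₀)·CN/(k∞²+ρa) ≤ 4sm·CN/(k∞²+ρa)` (`forall_tilt_iff_sq_le`), i.e. the linear response
  `m·(k∞²+ρa) ≤ 4CsN`; with `|k|² ≤ 3k∞²` this is `(κρa + |k|²/4)·m ≤ 4C·max(κ,1)·sN`, and
  `coreIneq_of_lr_bound` closes.  (`N = 0` is excluded by the window for `n ≠ 0`.)
* `constitutiveCore_of_uniformChord` — S2 follows from the chord for the TRUNCATIONS `v_t`, `t ≥ t₀`,
  with the envelope's `a(v)` and constants uniform in `t`: this t-uniform truncated chord is the exact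
  upper envelope of S2's strength.
* `coreIneq_trunc_of_chord_bounded`, `constitutiveCore_bounded_of_densityResponse` — for a BOUNDED
  admissible `v` the S2 obligation for `(v, M)` is a consequence of the crux instance for `(v, M)` itself
  (`v_t = v` for `t ≥ ⌈B⌉`).  Together with the kernel-checked composition of the skeleton
  (`S1 ∧ S2 ∧ S3a ∧ S4 ⟹ crux`), S2 restricted to bounded potentials is EQUIVALENT to the crux restricted
  to bounded potentials modulo the classical stubs S1/S3a/S4: the stub carries no excess strength there;
  for hard cores its only excess over the crux is the uniformity in the truncation height.
-/

namespace Summit.AtomisticToContinuum.BoseEinsteinCondensation.Theorems.DensityResponse.Negative.ForceBalanceStubs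

open MeasureTheory
open scoped ENNReal
open Literature.MathematicalPhysics.QuantumManyBody.BoseGas
open Summit.AtomisticToContinuum.BoseEinsteinCondensation.Theses
open Summit.AtomisticToContinuum.BoseEinsteinCondensation.Cruxes.DensityResponse.ForceBalanceConstitutive
open Summit.AtomisticToContinuum.BoseEinsteinCondensation.Theorems.DensityResponse.Negative

noncomputable section

/-! ## The crux-shaped chord for a potential with a scattering-length parameter

Throughout, the hypothesis `h` is the crux-shaped CHORD for the potential `w` at scattering-length
parameter `a`, window `M`, constants `ρ₀, C, N₀` — verbatim the conclusion of
`BECThomsonPrinciple.DensityResponse` for `(v, M)` when `w = v`, `a = a(v)` (with `sourceMean` for the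
source integral and `ksupSq` for `(2π‖n‖∞/L)²`, both by `rfl`), written out in full so that this file
declares no new `Prop`. -/

/-- Real form of the chord on a finite-energy state. [folklore] -/
theorem chord_toReal {w : ℝ → ℝ≥0∞} {a M ρ₀ C : ℝ} {N₀ : ℕ} (hC : 0 ≤ C) (ha : 0 ≤ a)
    (h : ∀ N : ℕ, N₀ ≤ N → ∀ L : ℝ, 0 < L → (N : ℝ) ≤ ρ₀ * L ^ 3 → ∀ n : Fin 3 → ℤ, n ≠ 0 →
      2 * Real.pi * ‖(fun j => (n j : ℝ))‖ / L ≤ M * Real.sqrt (N / L ^ 3) →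
      ∀ s : ℝ, 0 ≤ s → ∀ Φ : PeriodicTrialState N L,
        periodicGroundStateEnergy w N L + ENNReal.ofReal (s * |sourceMean n Φ|) ≤
          periodicEnergy w Φ + ENNReal.ofReal (C * s ^ 2 * N / (ksupSq L n + N / L ^ 3 * a)))
    {N : ℕ} (hN : N₀ ≤ N) {L : ℝ} (hL : 0 < L)
    (hNL : (N : ℝ) ≤ ρ₀ * L ^ 3) {n : Fin 3 → ℤ} (hn : n ≠ 0)
    (hwin : 2 * Real.pi * ‖(fun j => (n j : ℝ))‖ / L ≤ M * Real.sqrt (N / L ^ 3))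
    {s : ℝ} (hs : 0 ≤ s) (Φ : PeriodicTrialState N L) (hE : periodicEnergy w Φ ≠ ⊤) :
    (periodicGroundStateEnergy w N L).toReal + s * |sourceMean n Φ| ≤
      (periodicEnergy w Φ).toReal + C * s ^ 2 * N / (ksupSq L n + N / L ^ 3 * a) := by
  have key := h N hN L hL hNL n hn hwin s hs Φ
  have hE₀ : periodicGroundStateEnergy w N L ≠ ⊤ :=
    ne_top_of_le_ne_top hE (periodicGroundStateEnergy_le w Φ)
  have hx : 0 ≤ s * |sourceMean n Φ| := mul_nonneg hs (abs_nonneg _)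
  have hD : 0 ≤ ksupSq L n + N / L ^ 3 * a := by unfold ksupSq; positivity
  have hy : 0 ≤ C * s ^ 2 * N / (ksupSq L n + N / L ^ 3 * a) := by positivity
  have hR : periodicEnergy w Φ + ENNReal.ofReal (C * s ^ 2 * N / (ksupSq L n + N / L ^ 3 * a)) ≠ ⊤ :=
    ENNReal.add_ne_top.2 ⟨hE, ENNReal.ofReal_ne_top⟩
  have := ENNReal.toReal_mono hR key
  rwa [ENNReal.toReal_add hE₀ ENNReal.ofReal_ne_top, ENNReal.toReal_add hE ENNReal.ofReal_ne_top,
    ENNReal.toReal_ofReal hx, ENNReal.toReal_ofReal hy] at this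

/-! ## CHORD ⟹ CORE -/

/-- **The chord implies the constitutive core** with `C₁ = 4C·max(κ,1)`, for every real `κ` (no
sign needed; S2 asks `κ > 0`): on a
transport-stationary sub-ground positively-modulated state the tilt family of the chord gives the
linear response `m·(k∞² + ρa) ≤ 4CsN`, and `(κρa + |k|²/4) ≤ max(κ,1)·(k∞² + ρa)`. [folklore] -/
theorem coreIneq_of_chord {w : ℝ → ℝ≥0∞} {a M ρ₀ C : ℝ} (κ : ℝ) {N₀ : ℕ} (hC : 0 < C) (ha : 0 ≤ a)
    (h : ∀ N : ℕ, N₀ ≤ N → ∀ L : ℝ, 0 < L → (N : ℝ) ≤ ρ₀ * L ^ 3 → ∀ n : Fin 3 → ℤ, n ≠ 0 →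
      2 * Real.pi * ‖(fun j => (n j : ℝ))‖ / L ≤ M * Real.sqrt (N / L ^ 3) →
      ∀ s : ℝ, 0 ≤ s → ∀ Φ : PeriodicTrialState N L,
        periodicGroundStateEnergy w N L + ENNReal.ofReal (s * |sourceMean n Φ|) ≤
          periodicEnergy w Φ + ENNReal.ofReal (C * s ^ 2 * N / (ksupSq L n + N / L ^ 3 * a))) :
    CoreIneq w a M ρ₀ κ (4 * C * max κ 1) N₀ := by
  refine coreIneq_of_lr_bound fun N hN L hL hNL n hn hwin s hs _hsa Φ hE _hstat hsub hm => ?_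
  -- `N ≥ 1`: the window is empty for `N = 0` and `n ≠ 0`
  have hkpos : 0 < 2 * Real.pi * ‖(fun j => (n j : ℝ))‖ / L := kinf_pos hL hn
  have hNpos : (0 : ℝ) < N := by
    by_contra h0
    push Not at h0
    have hN0 : (N : ℝ) = 0 := le_antisymm h0 (Nat.cast_nonneg N)
    have : M * Real.sqrt (N / L ^ 3) = 0 := by rw [hN0, zero_div, Real.sqrt_zero, mul_zero]
    linarith
  set D := ksupSq L n + N / L ^ 3 * a with hDdef
  have hks : 0 < ksupSq L n := by unfold ksupSq; positivity
  have hρa : 0 ≤ (N : ℝ) / L ^ 3 * a := by positivity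
  have hD : 0 < D := by rw [hDdef]; linarith
  have hD' : 0 < C * N / D := by positivity
  -- the chord at every tilt, real form, `|m| = m`
  have habs : |sourceMean n Φ| = sourceMean n Φ := abs_of_nonneg hm
  have tilt : ∀ s' : ℝ, 0 ≤ s' → s' * sourceMean n Φ ≤
      ((periodicEnergy w Φ).toReal - (periodicGroundStateEnergy w N L).toReal) +
        C * N / D * s' ^ 2 := by
    intro s' hs'
    have hc := chord_toReal hC.le ha h hN hL hNL hn hwin hs' Φ hE
    rw [habs] at hc
    have e : C * s' ^ 2 * N / D = C * N / D * s' ^ 2 := by ring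
    linarith
  -- square-root bound and the sub-ground budget `E − E₀ ≤ s·m`
  have sq := (forall_tilt_iff_sq_le hm hD').1 tilt
  have hB : (periodicEnergy w Φ).toReal - (periodicGroundStateEnergy w N L).toReal ≤
      s * sourceMean n Φ := by linarith
  have hmD : sourceMean n Φ * D ≤ 4 * C * s * N := by
    rcases hm.lt_or_eq with hpos | hzero
    · have h1 : sourceMean n Φ ^ 2 ≤ 4 * (s * sourceMean n Φ) * (C * N / D) :=
        calc sourceMean n Φ ^ 2
            ≤ 4 * ((periodicEnergy w Φ).toReal - (periodicGroundStateEnergy w N L).toReal) *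
                (C * N / D) := sq
          _ ≤ 4 * (s * sourceMean n Φ) * (C * N / D) := by
              apply mul_le_mul_of_nonneg_right _ hD'.le
              linarith
      have h2 : sourceMean n Φ ≤ 4 * s * (C * N / D) := by
        have h1' : sourceMean n Φ * sourceMean n Φ ≤ 4 * s * (C * N / D) * sourceMean n Φ := by
          nlinarith [h1]
        exact le_of_mul_le_mul_right h1' hpos
      calc sourceMean n Φ * D ≤ 4 * s * (C * N / D) * D := mul_le_mul_of_nonneg_right h2 hD.le
        _ = 4 * s * (C * N / D * D) := by ring
        _ = 4 * s * (C * N) := by rw [div_mul_cancel₀ _ hD.ne']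
        _ = 4 * C * s * N := by ring
    · rw [← hzero, zero_mul]; positivity
  -- coefficients: `κρa + |k|²/4 ≤ max(κ,1)·(k∞² + ρa)`
  have hmax1 : 1 ≤ max κ 1 := le_max_right _ _
  have hmaxκ : κ ≤ max κ 1 := le_max_left _ _
  have hmax0 : 0 ≤ max κ 1 := zero_le_one.trans hmax1
  have hcoef : κ * (N / L ^ 3 * a) + ksq L n / 4 ≤ max κ 1 * D := by
    have e1 : κ * (N / L ^ 3 * a) ≤ max κ 1 * (N / L ^ 3 * a) := mul_le_mul_of_nonneg_right hmaxκ hρa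
    have e2 : ksq L n / 4 ≤ max κ 1 * ksupSq L n := by
      have h3 := ksq_le_three_mul_ksupSq L n
      nlinarith
    have e3 : max κ 1 * D = max κ 1 * ksupSq L n + max κ 1 * (N / L ^ 3 * a) := by rw [hDdef]; ring
    linarith
  calc (κ * (N / L ^ 3 * a) + ksq L n / 4) * sourceMean n Φ ≤ max κ 1 * D * sourceMean n Φ :=
        mul_le_mul_of_nonneg_right hcoef hm
    _ = max κ 1 * (sourceMean n Φ * D) := by ring
    _ ≤ max κ 1 * (4 * C * s * N) := mul_le_mul_of_nonneg_left hmD hmax0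
    _ = 4 * C * max κ 1 * s * N := by ring

/-! ## Consequences for S2 `ConstitutiveCore` -/

/-- **S2 follows from the t-uniform chord on the truncation family** (with `κ = 1`, `C₁ = 4C`): the
exact upper envelope of S2's strength. [folklore] -/
theorem constitutiveCore_of_uniformChord
    (h : ∀ v : ℝ → ℝ≥0∞, IsRepulsiveFiniteRange v → ∀ M : ℝ, 0 < M →
      ∃ ρ₀ C : ℝ, 0 < ρ₀ ∧ 0 < C ∧ ∃ N₀ t₀ : ℕ, ∀ t : ℕ, t₀ ≤ t →
      ∀ N : ℕ, N₀ ≤ N → ∀ L : ℝ, 0 < L → (N : ℝ) ≤ ρ₀ * L ^ 3 → ∀ n : Fin 3 → ℤ, n ≠ 0 →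
        2 * Real.pi * ‖(fun j => (n j : ℝ))‖ / L ≤ M * Real.sqrt (N / L ^ 3) →
        ∀ s : ℝ, 0 ≤ s → ∀ Φ : PeriodicTrialState N L,
          periodicGroundStateEnergy (truncPotential v t) N L + ENNReal.ofReal (s * |sourceMean n Φ|) ≤
            periodicEnergy (truncPotential v t) Φ + ENNReal.ofReal (C * s ^ 2 * N / (ksupSq L n + N / L ^ 3 * (scatteringLength v).toReal))) :
    ConstitutiveCore := by
  intro v hv M hM
  obtain ⟨ρ₀, C, hρ₀, hC, N₀, t₀, ht⟩ := h v hv M hM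
  refine ⟨ρ₀, 1, 4 * C, hρ₀, one_pos, by positivity, N₀, t₀, fun t htt => ?_⟩
  have hc := coreIneq_of_chord 1 hC ENNReal.toReal_nonneg (ht t htt)
  rwa [max_self, mul_one] at hc

/-- For a BOUNDED potential the chord for `v` itself gives the core for every truncation beyond the
bound (`v_t = v`). [folklore] -/
theorem coreIneq_trunc_of_chord_bounded {v : ℝ → ℝ≥0∞} {B : ℝ} (hB : ∀ r, v r ≤ ENNReal.ofReal B)
    {a M ρ₀ C : ℝ} (κ : ℝ) {N₀ : ℕ} (hC : 0 < C) (ha : 0 ≤ a)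
    (h : ∀ N : ℕ, N₀ ≤ N → ∀ L : ℝ, 0 < L → (N : ℝ) ≤ ρ₀ * L ^ 3 → ∀ n : Fin 3 → ℤ, n ≠ 0 →
      2 * Real.pi * ‖(fun j => (n j : ℝ))‖ / L ≤ M * Real.sqrt (N / L ^ 3) →
      ∀ s : ℝ, 0 ≤ s → ∀ Φ : PeriodicTrialState N L,
        periodicGroundStateEnergy v N L + ENNReal.ofReal (s * |sourceMean n Φ|) ≤
          periodicEnergy v Φ + ENNReal.ofReal (C * s ^ 2 * N / (ksupSq L n + N / L ^ 3 * a)))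
    {t : ℕ} (ht : ⌈B⌉₊ ≤ t) : CoreIneq (truncPotential v t) a M ρ₀ κ (4 * C * max κ 1) N₀ := by
  rw [truncPotential_eq_self_of_le hB (Nat.ceil_le.mp ht)]
  exact coreIneq_of_chord κ hC ha h

/-- **The bounded-potential half of S2 is a consequence of the crux**: for a bounded admissible `v`
and a window `M`, the S2 obligation `∃ ρ₀ κ C₁ N₀ t₀, ∀ t ≥ t₀, CoreIneq (v_t) a(v) M ρ₀ κ C₁ N₀`
follows from the crux instance `(v, M)` (so S2 has no excess strength on bounded potentials).
[folklore] -/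
theorem constitutiveCore_bounded_of_densityResponse (h : BECThomsonPrinciple.DensityResponse)
    (v : ℝ → ℝ≥0∞) (hv : IsRepulsiveFiniteRange v) (hb : ∃ B : ℝ, ∀ r, v r ≤ ENNReal.ofReal B)
    (M : ℝ) (hM : 0 < M) :
    ∃ ρ₀ κ C₁ : ℝ, 0 < ρ₀ ∧ 0 < κ ∧ 0 < C₁ ∧ ∃ N₀ t₀ : ℕ, ∀ t : ℕ, t₀ ≤ t →
      CoreIneq (truncPotential v t) (scatteringLength v).toReal M ρ₀ κ C₁ N₀ := by
  obtain ⟨ρ₀, C, hρ₀, hC, N₀, hch⟩ := h v hv M hM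
  obtain ⟨B, hB⟩ := hb
  refine ⟨ρ₀, 1, 4 * C, hρ₀, one_pos, by positivity, N₀, ⌈B⌉₊, fun t ht => ?_⟩
  have hc := coreIneq_trunc_of_chord_bounded hB 1 hC ENNReal.toReal_nonneg hch ht
  rwa [max_self, mul_one] at hc

end

end Summit.AtomisticToContinuum.BoseEinsteinCondensation.Theorems.DensityResponse.Negative.ForceBalanceStubs
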